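import Summits.AtomisticToContinuum.Crystallization.Theorems.ChartedZeroExcessLayeredLatticeLiouvilleZCA

/-!
# Part ZC «ClusterGap / BondLabel» (lens-2 g77) — part 2 of 2 (sequel of `…ChartedZeroExcessLayeredLatticeLiouvilleZCA`)

Split for the 400-line cap; the module docstring of part 1 (`…ChartedZeroExcessLayeredLatticeLiouvilleZCA`) describes the whole node.  Same namespace; all
FQNs unchanged.  This part: ZC-2 (the straddling star over explicit coordinates, the registry-shift dichotomies incl. the unconditional Barlow form) and
ZC-3 (NODE 77 «BondLabel»: `IsBond`, `IsBondLabel`, (GL) `BondLabelP`, (GC) `BondCoherenceP`, junction `singleVariantP_of_bondLabel` PROVED).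
0 sorry; standard axioms.
-/

noncomputable section
open scoped BigOperators Classical InnerProductSpace RealInnerProductSpace
open MeasureTheory Set Metric Filter Topology
open Summit.AtomisticToContinuum.Crystallization.Theorems.ChartedPlanarOrderRigidityDoor (E3 IsClean IsCharted)
open Summit.AtomisticToContinuum.Crystallization.Theorems.ChartedPlanarOrderDensityDichotomy (μS IsSep)
open Summit.AtomisticToContinuum.Crystallization.Theorems.ChartedPlanarOrderCleanScaleP (IsCleanP IsDoorSetP isCleanP_one_iff isCleanP_mono)
open Summit.AtomisticToContinuum.Crystallization.Theorems.ChartedPlanarOrderMesoCut (LayeredHom EnvClose)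
open Summit.AtomisticToContinuum.Crystallization.Theorems.ChartedPlanarOrderDoorLayeredOsc (IsTwoShellAffineGood mem_iff_μS_singleton_ne_zero)
open Literature.MathematicalPhysics.StatisticalMechanics (lennardJones triangularVec₁ triangularVec₂ barlowOffset layerNormal)
open Literature.Geometry.DiscreteGeometry (IsTwoShellGoodSet fccTwoShellPattern hcpTwoShellPattern norm_of_mem_fccTwoShellPattern
  norm_of_mem_hcpTwoShellPattern)

namespace Summit.AtomisticToContinuum.Crystallization.Theorems.ChartedZeroExcessLayeredLatticeLiouville

/-! ### ZC-2  The straddling star over EXPLICIT coordinates: the registry-shift dichotomy of one atom (all PROVED, `nlinarith` scale) -/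

section Straddle

/-- the STRADDLING ATOM above the lower close-packed layer through `0, u, v, u + v` (`u = triangularVec₁ 1`, `v = triangularVec₂ 1`), on the segment
from the `B`-hollow `w = barlowOffset 1` (`σ = 0`) to the `C`-hollow `2w` (`σ = 1`) at the ideal height `√(2/3)`:
`straddlePt σ = ((1+σ)/2, (1+σ)√3/6, √(2/3))`.  `σ` is the registry shift in HOLLOW units (`σ = √3 · s` for a lateral shift `s` in contact units).
[this file, g77] -/
def straddlePt (σ : ℝ) : E3 := !₂[(1 + σ) / 2, (1 + σ) * Real.sqrt 3 / 6, Real.sqrt (2 / 3)]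

/-- the far corner `u + v = (3/2, √3/2, 0)` of the lower rhombus (the atom the straddling atom APPROACHES as `σ → 1`). [this file, g77] -/
def lowerCorner : E3 := !₂[3 / 2, Real.sqrt 3 / 2, 0]

/-- `straddlePt_apply_zero` (docstring added by the landing lane; see the module docstring). [formal bookkeeping] -/
@[simp] theorem straddlePt_apply_zero (σ : ℝ) : straddlePt σ 0 = (1 + σ) / 2 := by simp [straddlePt]
/-- `straddlePt_apply_one` (docstring added by the landing lane; see the module docstring). [formal bookkeeping] -/
@[simp] theorem straddlePt_apply_one (σ : ℝ) : straddlePt σ 1 = (1 + σ) * Real.sqrt 3 / 6 := by simp [straddlePt]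
/-- `straddlePt_apply_two` (docstring added by the landing lane; see the module docstring). [formal bookkeeping] -/
@[simp] theorem straddlePt_apply_two (σ : ℝ) : straddlePt σ 2 = Real.sqrt (2 / 3) := by simp [straddlePt]
/-- `lowerCorner_apply_zero` (docstring added by the landing lane; see the module docstring). [formal bookkeeping] -/
@[simp] theorem lowerCorner_apply_zero : lowerCorner 0 = 3 / 2 := by simp [lowerCorner]
/-- `lowerCorner_apply_one` (docstring added by the landing lane; see the module docstring). [formal bookkeeping] -/
@[simp] theorem lowerCorner_apply_one : lowerCorner 1 = Real.sqrt 3 / 2 := by simp [lowerCorner]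
/-- `lowerCorner_apply_two` (docstring added by the landing lane; see the module docstring). [formal bookkeeping] -/
@[simp] theorem lowerCorner_apply_two : lowerCorner 2 = 0 := by simp [lowerCorner]

/-- DICTIONARY to the Barlow vocabulary: `straddlePt σ = (1 + σ) • w + √(2/3) e₃`. [this file, g77] -/
theorem straddlePt_eq (σ : ℝ) : straddlePt σ = (1 + σ) • barlowOffset 1 + layerNormal (Real.sqrt (2 / 3)) := by
  ext i
  fin_cases i
  all_goals simp [straddlePt, barlowOffset, layerNormal]
  all_goals ring

/-- DICTIONARY: `lowerCorner = u + v`. [this file, g77] -/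
theorem lowerCorner_eq : lowerCorner = triangularVec₁ 1 + triangularVec₂ 1 := by
  ext i
  fin_cases i
  all_goals simp [lowerCorner, triangularVec₁, triangularVec₂]
  all_goals norm_num

/-- the RECEDING bond: `dist(0, straddlePt σ)² = ((1 + σ)² + 2)/3` (`= 1` at `σ = 0`, `= 2` at `σ = 1`). [this file, g77] -/
theorem dist_sq_zero_straddlePt (σ : ℝ) : dist (0 : E3) (straddlePt σ) ^ 2 = ((1 + σ) ^ 2 + 2) / 3 := by
  have h3 : Real.sqrt 3 ^ 2 = 3 := Real.sq_sqrt (by norm_num)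
  have h23 : Real.sqrt (2 / 3) ^ 2 = 2 / 3 := Real.sq_sqrt (by norm_num)
  rw [EuclideanSpace.dist_sq_eq, Fin.sum_univ_three, Real.dist_eq, Real.dist_eq, Real.dist_eq, sq_abs, sq_abs, sq_abs,
    straddlePt_apply_zero, straddlePt_apply_one, straddlePt_apply_two, PiLp.zero_apply, PiLp.zero_apply, PiLp.zero_apply]
  linear_combination ((1 + σ) ^ 2 / 36) * h3 + h23

/-- the APPROACHING bond: `dist(u + v, straddlePt σ)² = ((2 − σ)² + 2)/3` (`= 2` at `σ = 0`, `= 1` at `σ = 1`). [this file, g77] -/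
theorem dist_sq_lowerCorner_straddlePt (σ : ℝ) : dist lowerCorner (straddlePt σ) ^ 2 = ((2 - σ) ^ 2 + 2) / 3 := by
  have h3 : Real.sqrt 3 ^ 2 = 3 := Real.sq_sqrt (by norm_num)
  have h23 : Real.sqrt (2 / 3) ^ 2 = 2 / 3 := Real.sq_sqrt (by norm_num)
  rw [EuclideanSpace.dist_sq_eq, Fin.sum_univ_three, Real.dist_eq, Real.dist_eq, Real.dist_eq, sq_abs, sq_abs, sq_abs,
    straddlePt_apply_zero, straddlePt_apply_one, straddlePt_apply_two, lowerCorner_apply_zero, lowerCorner_apply_one, lowerCorner_apply_two]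
  linear_combination ((2 - σ) ^ 2 / 36) * h3 + h23

/-- the two SHARED bonds keep contact length throughout: `dist(u, straddlePt σ)² = (σ² − σ + 3)/3 ∈ [11/12, 1]`. [this file, g77] -/
theorem dist_sq_vec₁_straddlePt (σ : ℝ) : dist (triangularVec₁ 1) (straddlePt σ) ^ 2 = (σ ^ 2 - σ + 3) / 3 := by
  have h3 : Real.sqrt 3 ^ 2 = 3 := Real.sq_sqrt (by norm_num)
  have h23 : Real.sqrt (2 / 3) ^ 2 = 2 / 3 := Real.sq_sqrt (by norm_num)
  have e0 : triangularVec₁ (1 : ℝ) 0 = 1 := by simp [triangularVec₁]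
  have e1 : triangularVec₁ (1 : ℝ) 1 = 0 := by simp [triangularVec₁]
  have e2 : triangularVec₁ (1 : ℝ) 2 = 0 := by simp [triangularVec₁]
  rw [EuclideanSpace.dist_sq_eq, Fin.sum_univ_three, Real.dist_eq, Real.dist_eq, Real.dist_eq, sq_abs, sq_abs, sq_abs,
    straddlePt_apply_zero, straddlePt_apply_one, straddlePt_apply_two, e0, e1, e2]
  linear_combination ((1 + σ) ^ 2 / 36) * h3 + h23

/-- … and `dist(v, straddlePt σ)² = (σ² − σ + 3)/3`. [this file, g77] -/
theorem dist_sq_vec₂_straddlePt (σ : ℝ) : dist (triangularVec₂ 1) (straddlePt σ) ^ 2 = (σ ^ 2 - σ + 3) / 3 := by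
  have h3 : Real.sqrt 3 ^ 2 = 3 := Real.sq_sqrt (by norm_num)
  have h23 : Real.sqrt (2 / 3) ^ 2 = 2 / 3 := Real.sq_sqrt (by norm_num)
  have e0 : triangularVec₂ (1 : ℝ) 0 = 1 / 2 := by simp [triangularVec₂]
  have e1 : triangularVec₂ (1 : ℝ) 1 = Real.sqrt 3 / 2 := by simp [triangularVec₂]
  have e2 : triangularVec₂ (1 : ℝ) 2 = 0 := by simp [triangularVec₂]
  rw [EuclideanSpace.dist_sq_eq, Fin.sum_univ_three, Real.dist_eq, Real.dist_eq, Real.dist_eq, sq_abs, sq_abs, sq_abs,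
    straddlePt_apply_zero, straddlePt_apply_one, straddlePt_apply_two, e0, e1, e2]
  linear_combination ((σ - 2) ^ 2 / 36) * h3 + h23

/-- the straddling atom is not in the lower plane. [this file, g77] -/
theorem zero_ne_straddlePt (σ : ℝ) : (0 : E3) ≠ straddlePt σ := by
  intro h
  have h2 : straddlePt σ 2 = Real.sqrt (2 / 3) := straddlePt_apply_two σ
  rw [← h, PiLp.zero_apply] at h2
  have : 0 < Real.sqrt (2 / 3) := Real.sqrt_pos.2 (by norm_num)
  linarith

/-- the far corner is not the straddling atom. [this file, g77] -/
theorem lowerCorner_ne_straddlePt (σ : ℝ) : lowerCorner ≠ straddlePt σ := by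
  intro h
  have h2 : straddlePt σ 2 = Real.sqrt (2 / 3) := straddlePt_apply_two σ
  rw [← h, lowerCorner_apply_two] at h2
  have : 0 < Real.sqrt (2 / 3) := Real.sqrt_pos.2 (by norm_num)
  linarith

/-- ★★ **CLEAN EXCLUSION, receding bond (PROVED)**: for a registry shift `σ ∈ [9/50, 14/25]` the receding bond has length in the door's gap
`(17/16, (9/10)(√2 − 1/16))`, so the straddling atom is NOT `(1/16, 9/10, aHi)`-clean (`aHi ≤ 1`) in ANY set containing it and the receding atom `0`.
[this file, g77] -/
theorem not_clean_straddle_receding {σ aHi : ℝ} (hσ₁ : 9 / 50 ≤ σ) (hσ₂ : σ ≤ 14 / 25) (haHi : aHi ≤ 1) {Y : Set E3} (h0 : (0 : E3) ∈ Y) :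
    ¬ IsTwoShellGoodSet (1 / 16) (9 / 10) aHi Y (straddlePt σ) := by
  have hsq := dist_sq_zero_straddlePt σ
  have hd0 : 0 ≤ dist (0 : E3) (straddlePt σ) := dist_nonneg
  obtain ⟨hs₁, hs₂⟩ := sqrt_two_window
  have hlow : 17 / 16 < dist (0 : E3) (straddlePt σ) :=
    lt_of_pow_lt_pow_left₀ 2 hd0 (by rw [hsq]; nlinarith)
  have hup : dist (0 : E3) (straddlePt σ) < 9 / 10 * (Real.sqrt 2 - 1 / 16) :=
    lt_of_pow_lt_pow_left₀ 2 (by linarith) (by rw [hsq]; nlinarith)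
  exact not_isTwoShellGoodSet_of_gap (by norm_num) (by norm_num) h0 (zero_ne_straddlePt σ) (by nlinarith) (by linarith)

/-- ★★ **CLEAN EXCLUSION, approaching bond (PROVED)**: for `σ ∈ [11/25, 41/50]` the approaching bond (to `u + v`) is in the gap; the straddling
atom is not clean in any set containing it and `u + v`. [this file, g77] -/
theorem not_clean_straddle_approaching {σ aHi : ℝ} (hσ₁ : 11 / 25 ≤ σ) (hσ₂ : σ ≤ 41 / 50) (haHi : aHi ≤ 1) {Y : Set E3}
    (h3 : lowerCorner ∈ Y) : ¬ IsTwoShellGoodSet (1 / 16) (9 / 10) aHi Y (straddlePt σ) := by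
  have hsq := dist_sq_lowerCorner_straddlePt σ
  have hd0 : 0 ≤ dist lowerCorner (straddlePt σ) := dist_nonneg
  obtain ⟨hs₁, hs₂⟩ := sqrt_two_window
  have hlow : 17 / 16 < dist lowerCorner (straddlePt σ) :=
    lt_of_pow_lt_pow_left₀ 2 hd0 (by rw [hsq]; nlinarith)
  have hup : dist lowerCorner (straddlePt σ) < 9 / 10 * (Real.sqrt 2 - 1 / 16) :=
    lt_of_pow_lt_pow_left₀ 2 (by linarith) (by rw [hsq]; nlinarith)
  exact not_isTwoShellGoodSet_of_gap (by norm_num) (by norm_num) h3 (lowerCorner_ne_straddlePt σ) (by nlinarith) (by linarith)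

/-- ★★★ **THE REGISTRY-SHIFT DICHOTOMY OF ONE STRADDLING ATOM (PROVED)**: if the straddling atom is CLEAN at some ceiling `aHi ≤ 1` in a set
containing the lower rhombus corners `0` and `u + v`, then its registry shift is SMALL (`σ < 9/50`, lateral shift `< 0.104` contact units) or
COMPLETES TO THE OTHER LETTER (`σ > 41/50`): the windows `[9/50, 14/25] ∪ [11/25, 41/50] = [9/50, 41/50]` are forbidden.  This is the first typed-and-
proved instance of the «straddling-star / cluster-gap» exclusion the lineage invoked in words (75E (EN) why-might-fail (a); ZB (SV)). [this file, g77] -/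
theorem straddle_dichotomy_of_clean {σ aHi : ℝ} (haHi : aHi ≤ 1) {Y : Set E3} (h0 : (0 : E3) ∈ Y) (h3 : lowerCorner ∈ Y)
    (hgood : IsTwoShellGoodSet (1 / 16) (9 / 10) aHi Y (straddlePt σ)) : σ < 9 / 50 ∨ 41 / 50 < σ := by
  by_contra hcon
  push Not at hcon
  obtain ⟨h₁, h₂⟩ := hcon
  by_cases hσ : σ ≤ 14 / 25
  · exact not_clean_straddle_receding h₁ hσ haHi h0 hgood
  · push Not at hσ
    exact not_clean_straddle_approaching (by linarith) h₂ haHi h3 hgood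

/-- ★★ **TAME EXCLUSION, receding bond (PROVED, conditional on the model's pair gap)**: if the model set `H` has no pair distance in `(1, √2)` (every
IDEAL Barlow stacking at contact `1`), then for `σ ∈ [7/25, 39/50]` the star of the straddling atom is NOT `1/10`-tame relative to `H` in any `S`
containing it and `0` (`1.1 < dist < √2 − 0.1`). [this file, g77] -/
theorem not_tame_straddle_receding {σ : ℝ} (hσ₁ : 7 / 25 ≤ σ) (hσ₂ : σ ≤ 39 / 50) {S H : Set E3}
    (hH : ∀ y ∈ H, ∀ y' ∈ H, dist y y' ≤ 1 ∨ Real.sqrt 2 ≤ dist y y') (hx : straddlePt σ ∈ S) (h0 : (0 : E3) ∈ S) :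
    ¬ IsTameStar (1 / 10) S H (straddlePt σ) := by
  have hsq := dist_sq_zero_straddlePt σ
  have hd0 : 0 ≤ dist (0 : E3) (straddlePt σ) := dist_nonneg
  obtain ⟨hs₁, hs₂⟩ := sqrt_two_window
  have hlow : 11 / 10 < dist (0 : E3) (straddlePt σ) :=
    lt_of_pow_lt_pow_left₀ 2 hd0 (by rw [hsq]; nlinarith)
  have hup : dist (0 : E3) (straddlePt σ) < Real.sqrt 2 - 1 / 10 :=
    lt_of_pow_lt_pow_left₀ 2 (by linarith) (by rw [hsq]; nlinarith)
  have h4 : dist (0 : E3) (straddlePt σ) ≤ 4 := by linarith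
  exact not_isTameStar_of_gap hH hx h0 h4 (by linarith) (by linarith)

/-- ★★ **TAME EXCLUSION, approaching bond (PROVED, conditional on the model's pair gap)**: `σ ∈ [11/50, 18/25]`, `u + v ∈ S`. [this file, g77] -/
theorem not_tame_straddle_approaching {σ : ℝ} (hσ₁ : 11 / 50 ≤ σ) (hσ₂ : σ ≤ 18 / 25) {S H : Set E3}
    (hH : ∀ y ∈ H, ∀ y' ∈ H, dist y y' ≤ 1 ∨ Real.sqrt 2 ≤ dist y y') (hx : straddlePt σ ∈ S) (h3 : lowerCorner ∈ S) :
    ¬ IsTameStar (1 / 10) S H (straddlePt σ) := by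
  have hsq := dist_sq_lowerCorner_straddlePt σ
  have hd0 : 0 ≤ dist lowerCorner (straddlePt σ) := dist_nonneg
  obtain ⟨hs₁, hs₂⟩ := sqrt_two_window
  have hlow : 11 / 10 < dist lowerCorner (straddlePt σ) :=
    lt_of_pow_lt_pow_left₀ 2 hd0 (by rw [hsq]; nlinarith)
  have hup : dist lowerCorner (straddlePt σ) < Real.sqrt 2 - 1 / 10 :=
    lt_of_pow_lt_pow_left₀ 2 (by linarith) (by rw [hsq]; nlinarith)
  have h4 : dist lowerCorner (straddlePt σ) ≤ 4 := by linarith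
  exact not_isTameStar_of_gap hH hx h3 h4 (by linarith) (by linarith)

/-- ★★★ **THE REGISTRY-SHIFT DICHOTOMY, TAME FORM (PROVED, conditional on the model's pair gap `(1, √2)`)**: a `1/10`-tame straddling star (in an
`S` containing `0` and `u + v`) has `σ < 11/50` or `σ > 39/50` — the windows `[11/50, 18/25] ∪ [7/25, 39/50] = [11/50, 39/50]` are forbidden
(`s = σ/√3 ∈ (0.127, 0.450)`: the interval `(0.125, 0.452)` of critic row 1363, up to rounding).  HONEST SCOPE: the gap `(1, √2)` is that of an IDEAL
model; for the chart crystal `H = LayeredHom L w` of (QE) the gap is `(a_H(1+s′), a_H(√2−s′))` and must be supplied — a distance-only tame exclusion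
from «`H` clean» alone is EMPTY (its gap `(1.0625, 1.2165)` is narrower than `2ϑp`). [this file, g77] -/
theorem straddle_dichotomy_of_tame {σ : ℝ} {S H : Set E3} (hH : ∀ y ∈ H, ∀ y' ∈ H, dist y y' ≤ 1 ∨ Real.sqrt 2 ≤ dist y y')
    (hx : straddlePt σ ∈ S) (h0 : (0 : E3) ∈ S) (h3 : lowerCorner ∈ S) (htame : IsTameStar (1 / 10) S H (straddlePt σ)) :
    σ < 11 / 50 ∨ 39 / 50 < σ := by
  by_contra hcon
  push Not at hcon
  obtain ⟨h₁, h₂⟩ := hcon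
  by_cases hσ : σ ≤ 18 / 25
  · exact not_tame_straddle_approaching h₁ hσ hH hx h3 htame
  · push Not at hσ
    exact not_tame_straddle_receding (by linarith) h₂ hH hx h0 htame

end Straddle

section BarlowCorollary

open Literature.MathematicalPhysics.StatisticalMechanics (IsHaggSeq barlowStacking)

/-- ★★★ **THE REGISTRY-SHIFT DICHOTOMY, TAME FORM, UNCONDITIONAL FOR IDEAL MODELS (PROVED)**: relative to ANY ideal Barlow stacking
`H = barlowStacking 1 √(2/3) s′` (`s′` Hägg), a `1/10`-tame straddling star (in an `S` containing `0` and `u + v`) has `σ < 11/50` or `σ > 39/50`.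
[this file, g77] -/
theorem straddle_dichotomy_of_tame_barlow {σ : ℝ} {s' : ℤ → ℤ} (hs' : IsHaggSeq s') {S : Set E3} (hx : straddlePt σ ∈ S) (h0 : (0 : E3) ∈ S)
    (h3 : lowerCorner ∈ S) (htame : IsTameStar (1 / 10) S (barlowStacking 1 (Real.sqrt (2 / 3)) s') (straddlePt σ)) :
    σ < 11 / 50 ∨ 39 / 50 < σ :=
  straddle_dichotomy_of_tame (barlow_pair_gap hs') hx h0 h3 htame

end BarlowCorollary

/-! ### ZC-3  NODE 77 «BondLabel»: (SV) cut through the door's GLOBAL BOND CHART into (GL) ∧ (GC); the junction PROVED -/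

section BondLabel

/-- N's chart bond: `0 < dist p q ≤ 28/25` (the right-hand side of `IsCharted`'s `dist = 1 ↔ …`).  In a door set (`aHi ≤ 1`) this is EXACTLY a
first-shell contact `dist ≤ (17/16)·aHi` (`door_bond_iff`): the threshold sits in the pair gap. [this file, g77] -/
def IsBond (p q : E3) : Prop := 0 < dist p q ∧ dist p q ≤ 28 / 25

/-- bonds are symmetric. [this file, g77] -/
theorem IsBond.symm {p q : E3} (h : IsBond p q) : IsBond q p := by
  unfold IsBond at h ⊢; rwa [dist_comm]

/-- ★ in a door set (`aHi ≤ 1`) a bond is a contact of DISTINCT atoms at distance `≤ (17/16)·aHi`, and conversely. [this file, g77] -/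
theorem isBond_iff_of_isDoorSetP {aHi δ : ℝ} (haHi : aHi ≤ 1) {S : Set E3} (hS : IsDoorSetP aHi δ S) {p q : E3} (hp : p ∈ S) (hq : q ∈ S) :
    IsBond p q ↔ p ≠ q ∧ dist p q ≤ 17 / 16 * aHi := by
  rw [IsBond, door_bond_iff haHi hS hp hq, dist_pos]

/-- ★★ **`IsBondLabel ε r ℓ S K C lab` — a BOND LABEL of the atoms near `K` into the crystal `C`** (the COMBINATORIAL object of this node): (i) every
atom of the `ℓ`-zone of `K` (`dist(·, k) < ℓ` for some `k ∈ K`) is sent to a site of `C` [= clause (i) of `IsVariantLabel`]; (b) BONDS GO TO BONDS: two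
zone atoms at `0 < dist ≤ 28/25` have labels at `0 < dist ≤ 28/25`; (c) `lab` is INJECTIVE on the zone; (iv) on the cool zone (`r < dist(·, K)`) it
extends the collar registration, `dist p (lab p) ≤ ε` [= clause (iv) of `IsVariantLabel`].  NO metric statement about loose atoms: a bond label is a
graph-theoretic object (an embedding of the zone's contact graph into `C`'s) pinned on the collar. [this file, g77] -/
def IsBondLabel (ε r ℓ : ℝ) (S K C : Set E3) (lab : E3 → E3) : Prop :=
  (∀ p ∈ S, (∃ k ∈ K, dist p k < ℓ) → lab p ∈ C) ∧
    (∀ p ∈ S, ∀ p' ∈ S, (∃ k ∈ K, dist p k < ℓ) → (∃ k ∈ K, dist p' k < ℓ) → IsBond p p' → IsBond (lab p) (lab p')) ∧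
      InjOn lab {p | p ∈ S ∧ ∃ k ∈ K, dist p k < ℓ} ∧
        ∀ p ∈ S, (∃ k ∈ K, dist p k < ℓ) → (∀ k ∈ K, r < dist p k) → dist p (lab p) ≤ ε

/-- a bond label already carries clauses (i) and (iv) of a variant label. [this file, g77] -/
theorem IsBondLabel.into {ε r ℓ : ℝ} {S K C : Set E3} {lab : E3 → E3} (h : IsBondLabel ε r ℓ S K C lab) :
    (∀ p ∈ S, (∃ k ∈ K, dist p k < ℓ) → lab p ∈ C) ∧ ∀ p ∈ S, (∃ k ∈ K, dist p k < ℓ) → (∀ k ∈ K, r < dist p k) → dist p (lab p) ≤ ε :=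
  ⟨h.1, h.2.2.2⟩

/-- a bond label separates distinct zone atoms (injectivity, pointwise form). [this file, g77] -/
theorem IsBondLabel.ne {ε r ℓ : ℝ} {S K C : Set E3} {lab : E3 → E3} (h : IsBondLabel ε r ℓ S K C lab) {p p' : E3} (hp : p ∈ S) (hp' : p' ∈ S)
    (hz : ∃ k ∈ K, dist p k < ℓ) (hz' : ∃ k ∈ K, dist p' k < ℓ) (hne : p ≠ p') : lab p ≠ lab p' :=
  fun e => hne (h.2.2.1 ⟨hp, hz⟩ ⟨hp', hz'⟩ e)

/-- a bond label is one for a larger collar tolerance and a smaller zone (WEAKER). [this file, g77] -/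
theorem IsBondLabel.mono {ε ε' r ℓ ℓ' : ℝ} {S K C : Set E3} {lab : E3 → E3} (hε : ε ≤ ε') (hℓ : ℓ' ≤ ℓ) (h : IsBondLabel ε r ℓ S K C lab) :
    IsBondLabel ε' r ℓ' S K C lab := by
  obtain ⟨h₁, h₂, h₃, h₄⟩ := h
  have hz : ∀ {p : E3}, (∃ k ∈ K, dist p k < ℓ') → ∃ k ∈ K, dist p k < ℓ := fun ⟨k, hk, hd⟩ => ⟨k, hk, lt_of_lt_of_le hd hℓ⟩
  exact ⟨fun p hp h => h₁ p hp (hz h), fun p hp p' hp' h h' hb => h₂ p hp p' hp' (hz h) (hz h') hb,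
    fun p hp p' hp' e => h₃ ⟨hp.1, hz hp.2⟩ ⟨hp'.1, hz hp'.2⟩ e, fun p hp h hc => (h₄ p hp (hz h) hc).trans hε⟩

/-- NON-VACUITY: the identity is a bond label of `S` into any `C ⊇ S` (collar tolerance `ε ≥ 0`). [this file, g77] -/
theorem isBondLabel_id {ε r ℓ : ℝ} {S K C : Set E3} (hSC : S ⊆ C) (hε : 0 ≤ ε) : IsBondLabel ε r ℓ S K C id :=
  ⟨fun p hp _ => hSC hp, fun _ _ _ _ _ _ hb => hb, fun _ _ _ _ e => e, fun p _ _ _ => by rw [id, dist_self]; exact hε⟩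

/-- ★★★ **(GL) «BondLabelP ϑc ϑp r q rsh rm σ ϑr Rs ε rI ℓ aHi Λ θ s» — A BOND LABEL INTO THE SHELL CRYSTAL EXISTS** (piece 1 of NODE 77; the
ORDER-lite, COMBINATORIAL half of (SV)).  Under the binders of (QE)/(SV) verbatim, for every cool shadow crystal `C = placedCrystal L′ w′ U t`: some
`lab` is a bond label `IsBondLabel ε r ℓ S K C lab`.  MECHANISM (why TRUE-leaning): the door is CHARTED (`IsCharted (μS S)`, a conjunct of `IsDoorSetP`,
UNEXPLOITED by the lineage so far): a bijection `Φ : barlowStacking 1 √(2/3) s ≃ S` carrying Barlow contacts (`dist = 1`) EXACTLY onto bonds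
(`0 < dist ≤ 28/25` = first-shell contacts `≤ 17/16·aHi`, `door_bond_iff` — the threshold sits in the pair gap `door_pair_gap`).  So every close-packed
LAYER of `S` is a GLOBAL sheet `Φ(barlowLayer k)` crossing the collar; REG-out restricted to a sheet's collar ANNULUS is a bond-preserving injective map
between triangular-lattice regions, hence AFFINE (discrete rigidity of triangulated annuli) and extends over the disc inside the loose ball; inter-sheet
bonds are preserved because the hollow class of sheet `k+1` over sheet `k` (the Hägg letter `s k`) and `C`'s per-layer registry `w′` are both GLOBAL per
layer pair and agree on the collar.  The twin-lamella adversary of (SV) does not exist here: a lamella CONFINED to the ball is not a union of global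
sheets.  WEAKER IN KIND than (SV): no metric clause on loose atoms.  UNDECIDED→TRUE-leaning · ATTACKABLE-M (combinatorics of `Φ` + the collar
registration; no LJ analysis) · INSTRUMENTABLE «Row-G» (read `Φ`-coordinates of census cores, extend REG-out sheet-wise, test bond preservation).
Why it might fail: REG-out (`ε = 10⁻⁴`-registration on the cool zone) must itself be bond-preserving AND injective towards `C` and its sheet-wise index
map affine on an annulus that is CONNECTED and triangulated for every sheet meeting the `ℓ`-zone — sheets nearly tangent to the zone's boundary sphere
meet it in a thin cap/annulus where connectedness of the collar part can fail (repair: shrink the labelled zone to `ℓ − O(1)` or label only sheets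
meeting the loose ball). Sources: `IsCharted` (N, `…ChartedPlanarOrderRigidityDoor`), [cite: ConwaySloane1999, Ch. 1 §1.3], this file ZC-1. [this file, g77] -/
def BondLabelP (ϑc ϑp r q rsh rm σ ϑr Rs ε rI ℓ aHi Λ θ s : ℝ) : Prop :=
  ∀ δ : ℝ, 0 < δ → ∀ a : ℝ, 0 < a →
    ∀ S : Set E3, IsDoorSetP aHi δ S → (∀ z : E3, Summable fun y : S => lennardJones (dist z (y : E3))) →
      (∀ p ∈ S, IsTwoShellAffineGood θ S p) →
        ∀ (L : E3 ≃L[ℝ] E3) (w : ℤ → E3), IsEquilChart a s Λ L w →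
          ∀ (x₀ : E3) (K : Set E3), K ⊆ S → (∀ k ∈ K, dist k x₀ ≤ q) →
            IsTameOn ϑp S (LayeredHom (L : E3 →L[ℝ] E3) w) (coreOf S K rm) →
              IsTameOn ϑc S (LayeredHom (L : E3 →L[ℝ] E3) w) (moatIn S K r (r + rsh)) →
                ∀ (L' : E3 →L[ℝ] E3) (w' : ℤ → E3) (U : E3 ≃ₗᵢ[ℝ] E3) (t : E3),
                  IsCoolShadowCrystal σ ϑr Rs ε r rI ℓ S K (LayeredHom (L : E3 →L[ℝ] E3) w) L' w' U t →
                    ∃ lab : E3 → E3, IsBondLabel ε r ℓ S K (placedCrystal L' w' U t) lab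

/-- ★★★ **(GC) «BondCoherenceP ϑc ϑp r q rsh rm σ ϑr Rs ε rI ℓ τ aHi Λ θ s» — EVERY BOND LABEL IS COHERENT ON TAME STARS** (piece 2 of NODE 77;
the METRIC, LOCAL half of (SV)).  Under the binders verbatim and for every cool shadow crystal `C`: EVERY bond label `lab` satisfies clauses (ii) and
(iii) of `IsVariantLabel ϑp τ ε r rm ℓ S K C lab` — centre pairs of `ϑp`-tame stars of `coreOf S K rm` to `ϑp + τ`, star pairs to `2ϑp + τ`.
MECHANISM: a bond label restricted to the `4`-star of a clean, `ϑp`-tame atom `x` is an injective contact-graph homomorphism of a radius-`4` Barlow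
cluster into the near-ideal crystal `C`; the `12` contacts of `x` go to the `12` contacts of `lab x`, the link graph (cuboctahedron / anticuboctahedron,
both `4`-regular on `12` vertices with `24` edges, NOT isomorphic) is carried isomorphically, so the pattern TYPE is preserved and the star is relabelled
by a graph automorphism = a lattice isometry; second and further shells are forced site by site (each new site is bonded to `≥ 3` placed non-collinear
sites).  Hence `dist (lab x) (lab p)` is `C`'s realisation of the SAME Barlow index difference that `H` realises as `dist (g x) (g p)` for the tameness
witness `(U, g)`: `|dist x p − dist (lab x)(lab p)| ≤ ϑp + |d_H − d_C| ≤ ϑp + 2ϑr + η_H`.  WEAKER IN KIND than (SV): no existence content, local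
(one star at a time), adversary-free.  UNDECIDED · ATTACKABLE-S/M · INSTRUMENTABLE «Row-R» below.
Why it might fail (NEW, g77 — a hidden dependency of (SV) at `τ = 1/3000`): the budget needs the chart crystal `H = LayeredHom L w` to be
REPRODUCIBLE — radius-`4` environments of `H`-sites with equal letter words congruent within `η_H ≤ τ − 2ϑr ≈ 1.3·10⁻⁴` — because tameness at a deep
atom may be witnessed at an `H`-site other than the one `C` shadows near `lab x`; `IsEquilChart` (clean + single-site Nash + conf chart) is not known to
force this: (a) registry modes of single-site-Nash layered homs beyond uniform shear (linearised lateral force recurrence), (b) letter-dependent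
equilibrium spacings in MIXED stacking words (LJ `r⁻⁶` tail at `2h`: `Δh ∼ 10⁻⁴–10⁻³`).  Pattern-TYPE confusion is excluded with room to spare: the
bottleneck distortion between the centred cuboctahedron and anticuboctahedron over ALL bijections is `√2 − 1 ≈ 0.414` (exhaustive branch-and-bound,
cell folder `dev/distortion.py`; natural bijection optimal) `≫ 2ϑp + slop`.  INSTRUMENT «Row-R»: relax mixed-letter layered homs under single-site Nash
and report the spread of radius-`4` environments per letter word (PASS iff `≤ 1.3·10⁻⁴`).  Sources: this file ZC-1/ZC-2 (gap lemmas), tree `IsTameStar`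
(UC), `IsCoolShadowCrystal` (YZ), [cite: HalesDSP2012, §1.3]. [this file, g77] -/
def BondCoherenceP (ϑc ϑp r q rsh rm σ ϑr Rs ε rI ℓ τ aHi Λ θ s : ℝ) : Prop :=
  ∀ δ : ℝ, 0 < δ → ∀ a : ℝ, 0 < a →
    ∀ S : Set E3, IsDoorSetP aHi δ S → (∀ z : E3, Summable fun y : S => lennardJones (dist z (y : E3))) →
      (∀ p ∈ S, IsTwoShellAffineGood θ S p) →
        ∀ (L : E3 ≃L[ℝ] E3) (w : ℤ → E3), IsEquilChart a s Λ L w →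
          ∀ (x₀ : E3) (K : Set E3), K ⊆ S → (∀ k ∈ K, dist k x₀ ≤ q) →
            IsTameOn ϑp S (LayeredHom (L : E3 →L[ℝ] E3) w) (coreOf S K rm) →
              IsTameOn ϑc S (LayeredHom (L : E3 →L[ℝ] E3) w) (moatIn S K r (r + rsh)) →
                ∀ (L' : E3 →L[ℝ] E3) (w' : ℤ → E3) (U : E3 ≃ₗᵢ[ℝ] E3) (t : E3),
                  IsCoolShadowCrystal σ ϑr Rs ε r rI ℓ S K (LayeredHom (L : E3 →L[ℝ] E3) w) L' w' U t →
                    ∀ lab : E3 → E3, IsBondLabel ε r ℓ S K (placedCrystal L' w' U t) lab →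
                      (∀ x ∈ coreOf S K rm, ∀ p ∈ S, dist p x ≤ 4 → |dist x p - dist (lab x) (lab p)| ≤ ϑp + τ) ∧
                        ∀ y ∈ coreOf S K rm, ∀ x ∈ S, ∀ p ∈ S, dist x y ≤ 4 → dist p y ≤ 4 →
                          |dist x p - dist (lab x) (lab p)| ≤ 2 * ϑp + τ

/-- ★★★ **JUNCTION OF NODE 77 (PROVED)**: (GL) ∧ (GC) ⟹ (SV) — the bond label supplied by (GL) is, by (GC), coherent on tame stars; with its own
clauses (i)/(iv) it is a variant label.  Parameters free. [this file, g77] -/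
theorem singleVariantP_of_bondLabel {ϑc ϑp r q rsh rm σ ϑr Rs ε rI ℓ τ aHi Λ θ s : ℝ}
    (hGL : BondLabelP ϑc ϑp r q rsh rm σ ϑr Rs ε rI ℓ aHi Λ θ s) (hGC : BondCoherenceP ϑc ϑp r q rsh rm σ ϑr Rs ε rI ℓ τ aHi Λ θ s) :
    SingleVariantP ϑc ϑp r q rsh rm σ ϑr Rs ε rI ℓ τ aHi Λ θ s := by
  intro δ hδ a ha S hS hsum hgood L w hL x₀ K hKS hKq hTp hTc L' w' U t hC
  obtain ⟨lab, hlab⟩ := hGL δ hδ a ha S hS hsum hgood L w hL x₀ K hKS hKq hTp hTc L' w' U t hC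
  obtain ⟨h₂, h₃⟩ := hGC δ hδ a ha S hS hsum hgood L w hL x₀ K hKS hKq hTp hTc L' w' U t hC lab hlab
  exact ⟨lab, hlab.1, h₂, h₃, hlab.2.2.2⟩

/-- ★ **NODE 77 AT THE CONSTANTS OF RECORD (PROVED)**: `(GL) ∧ (GC) ⟹ (SV)` at `(ϑp, r, q, rsh, rm, σ, ϑr, Rs, ε, rI, ℓ, τ, aHi, Λ, θ, s) =
(1/10, 8, 4, 12, 16, 17/20, 10⁻⁴, 5, 10⁻⁴, 10, 43/2, 1/3000, 1, 2, 1/16, 1/50)`, `ϑc` free — feeding ZB's `coolMoat…_of_singleVariant` chain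
unchanged. [this file, g77] -/
theorem singleVariantP_record_of_bondLabel {ϑc : ℝ}
    (hGL : BondLabelP ϑc (1 / 10) 8 4 12 16 (17 / 20) (1 / 10000) 5 (1 / 10000) 10 (43 / 2) 1 2 (1 / 16) (1 / 50))
    (hGC : BondCoherenceP ϑc (1 / 10) 8 4 12 16 (17 / 20) (1 / 10000) 5 (1 / 10000) 10 (43 / 2) (1 / 3000) 1 2 (1 / 16) (1 / 50)) :
    SingleVariantP ϑc (1 / 10) 8 4 12 16 (17 / 20) (1 / 10000) 5 (1 / 10000) 10 (43 / 2) (1 / 3000) 1 2 (1 / 16) (1 / 50) :=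
  singleVariantP_of_bondLabel hGL hGC

/-- ★ THE LEVER IS LIVE UNDER THE BINDERS (PROVED): in any door set of the record ceiling `aHi = 1`, bonds are exactly first-shell contacts of distinct
atoms (`dist ≤ 17/16`) and NO pair of atoms sits at a distance in `(17/16, 6/5]` — so the contact graph that (GL) embeds and (GC) reads is canonically
defined, with margin `> 0.13` on either side of the chart threshold `28/25`. [this file, g77] -/
theorem bond_dictionary_record {δ : ℝ} {S : Set E3} (hS : IsDoorSetP 1 δ S) {p q : E3} (hp : p ∈ S) (hq : q ∈ S) :
    (IsBond p q ↔ p ≠ q ∧ dist p q ≤ 17 / 16) ∧ (17 / 16 < dist p q → 6 / 5 < dist p q) := by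
  refine ⟨?_, fun h => door_pair_gap' hS hp hq (by linarith)⟩
  rw [isBond_iff_of_isDoorSetP le_rfl hS hp hq, mul_one]

end BondLabel

end Summit.AtomisticToContinuum.Crystallization.Theorems.ChartedZeroExcessLayeredLatticeLiouville
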